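import Literature.MathematicalPhysics.QuantumFieldTheory.Balaban1983to89.T4PatternLayer
import Literature.MathematicalPhysics.QuantumFieldTheory.Balaban1983to89.T4SupCloseLiaison

/-!
# T⁴ programme, spine node NE7c (U5b) — ROAD P3 «SMOOTHING»: the single-run shell-weight bound
# `T4IndicatorShell.ShellWeightBound` for the Lipschitz-profiled (η) layer, END TO END, with NO NE7c-own estimate binder

Cell `pub-balaban`, BINDER-OWNERS row NE7c, co-owner #3 = unit `b2b-balaban-t4-ne7c-p3` (technique «smoothing route:
replace the sharp threshold indicators by a smooth partition»), ROUND-2 skeleton `HOME/t4/skeletons/NE7c-t4-ne7c-p3.md`.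
This module is the road's END FACE: ONE theorem per face whose conclusion is LITERALLY `ShellWeightBound …` (the tree name of
NE7c, `T4IndicatorShell` l. 403) and whose hypotheses are the skeleton's leaves, assembled BY NAME from landed modules of three
other lineages (`T4LipschitzCutoff` / `T4SiblingInsertion` — t4-ne7c-p2, design (η); `T4LipschitzLedger` / `T4AgeZeroLayer` /
`T4PatternLayer` — pv07, the U5b owner; `T4SupCloseLiaison` — pv25, the U1b liaison).  Nothing is re-proved; the value is the
ASSEMBLY and its binder list.

THE ROAD IN ONE PARAGRAPH.  In BOTH runs every background-mediated small- and large-field characteristic function of the live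
window (ages `a ≤ N₀`, cell convention [CONV-D]) is replaced by a Lipschitz profile `χ_a(u/θ)` of FIXED relative transition
width `κ_a` inside the printed threshold-ladder slack (`T4LipschitzCutoff` §4–§5: `κ_adm ≥ min(β/10 − (β/5)L⁻², (3/8)β²2^{−(M+2)})`,
Lipschitz constant `L_a = κ_a⁻¹`).  Then the two runs' factor products split as COMMON MIN-CORE + MIN-PIECES
(`prod_eq_prod_core_add_sum_minPiece`), each min-piece is POINTWISE at most `L_a · ρ(K − a) ×` the slot's own shell-restricted
sibling (`minPiece_profile_mul_le_shell`, `ρ` = the two-run relative sup-closeness of the tested variables BY LEVEL), and the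
siblings of a flip-closed (all-patterned) term family total at most TWICE the run's own partition function by the polarity-flip
involution (`T4AgeZeroLayer.siblingSuppression_two_of_flip`, `T4PatternLayer.siblingSuppression_layer₂`) — a reindexing
identity, NOT an estimate.  Hence `Wsh_K = Σ_{a ≤ N₀} n_a · L_a · 2 · ρ(K − a)`, summable iff `ρ` is, and `ρ` is node U1b's
(spine estimate NE3's) `LocalRate` read at the slot's level (`T4SupCloseLiaison.supClose_of_localRate`).  NO law of the tested
variable, NO anti-concentration, NO integration by parts, NO large-field small factor, NO survival condition enters.

WHY NO INTEGRATION BY PARTS (the second clause of the road's brief, «bound the shell weight by the derivative of the tested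
variable's distribution (integration by parts on the small-field Gaussian part)»).  With a profile of width `κθ` the derivative
that is paid is the PROFILE's, `sup|χ'| = L/θ ≤ (κθ)⁻¹`, times the two-run discrepancy `ρθ` — the factor `L·ρ = ρ/κ` of
`T4LipschitzCutoff.profile_sub_min_le_rel`; the derivative of the DISTRIBUTION of `u` (a density bound, by Malliavin-type
integration by parts against the small-field Gaussian part) is exactly road P1's anti-concentration input (M1)
`T4ShellMeasure.SlotAntiConcentration`, whose every smooth grounding needs a quantitative transversality of Bałaban's minimiser
that is NOT PRINTED (record `t4/T4-EST-NE7c-P1.md` §3 (α)–(ε), dead ends D1–D20).  §1 records the dichotomy in the kernel: at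
width `κ = ρ` (the brief's literal «width ρ_jθ_i») the transfer factor is `L·ρ ≥ 1` — NO GAIN (`no_transfer_gain_at_width_eq`),
so smoothing at the discrepancy scale degenerates into road P1; at FIXED admissible `κ` the gain is `ρ/κ` with NO law of `u`
(`transfer_factor_linProfile`).  Road P3 therefore takes `κ` fixed and needs no density of any law.

WHAT IS PROVED (kernel; 0 sorry; every hypothesis a displayed binder; NOTHING of Bałaban's asserted):
* §1 `no_transfer_gain_at_width_eq`, `transfer_factor_linProfile` — the width dictum above.
* §2 **`shellWeightBound_patterned`** (END-W): for the ALL-PATTERNED (η)-layer of `T4PatternLayer` (older histories `τ' ∈ T₀ K`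
  with `K`-free window depth `NW₀ τ' ≤ K`, `m₀ K τ'` declared profile factors in slots of ages `≤ N₀` with `< n a` copies and
  age `≤ K`, ONE factor per slot, positive thresholds, measurable window functionals `vA`/`vB`, a.e.-nonnegative integrable
  older weights `RA`/`RB` on the two runs' finest levels): the two-run closeness `hvc` of the window functionals with a
  nonnegative SUMMABLE width `ρ` ALONE gives `ShellWeightBound l₀ (layerT₂ T₀ m₀) A B shA shB (K ↦ Σ_{a≤N₀} n a·lipWeight L 2 ρ a K)`
  for the layer's term weights `A`/`B` (`layerX₂`, DEFINED as the representing integrals) and their realized shell parts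
  `shA`/`shB` (`T4LipschitzLedger.shellW` on the window) — sibling suppression `S ≡ 2` DISCHARGED by the flip involution, the
  fixed block EMPTY ([CONV-D]).
* §3 **`shellWeightBound_patterned_of_localRate`** (END-R): END-W with `hvc` DISCHARGED from node U1b's `T4EtaRateMin.LocalRate R C ϑ`
  (`0 ≤ C`, `0 ≤ ϑ < 1`; spine estimate NE3's output shape — a BINDER) through the realisation convention `ReadsLevels` and a
  positive threshold floor `θmin` over the window (`T4SupCloseLiaison`), width `ρ_j = (C/θmin)ϑ^j`.
* §4 the PRICE faces: `tsum_bandWeight_patterned` (`Σ_K Wsh_K = C₀(n, 2L)·(C/θmin)(1 − ϑ)⁻¹`, closed form),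
  `bandWeight_patterned_le_geometric` (`Wsh_K ≤ const·ϑ^K`), `budget_tail` (`W_K + Wsh_K < 1` EVENTUALLY whenever NE7b's `W_K` is
  eventually `≤ 1/2` — the only form the seam-(ζ′) socket `T4MatchingClosureSocket.hybridNE7_closure'_tail` consumes).

WHAT THIS IS NOT.  NOT a proof of NE7c for Bałaban's objects: no seat has instantiated the layer data (`T₀`, slots, `vA`/`vB`,
`RA`/`RB`) on the two runs' densities (NODE O of every spine row; owner of the (η) instantiation = pv07, item (o1-inst) of record
`t4/T4-EST-U5bE2.md` §27.7); `LocalRate` is spine estimate NE3 (NOT PRINTED: B11 prints η-UNIFORM regularity only); the single-run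
validity of the profiled procedure is the LOCATED page census of `t4/T4-EST-NE7c-P2.md` §6–§7 (class I empty, class D on kept-sharp
functions only) — an H2-type programme hypothesis, never minted as a fact; [CONV-D] is a cell CONVENTION (ruling R-ηW).  HONEST
FRAMING (T4-DAG p. 1): FIXED finite T⁴, rung (B)+1 = existence and uniqueness of the ε → 0 limit of gauge-invariant observables,
CONDITIONAL on BetaPertH ∧ the spine estimates — NOT infinite volume, NOT a mass gap, NOT the Clay problem, NOT summit progress.
HONEST DEPENDENCY: continuum YM on T⁴ ⇐ BetaPertH ∧ nine spine estimates (0/9 proved); BetaPertH ⇐ (D1) ∧ (D4) ∧ CAP+tail;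
G-an2-4 gates asym, D1 and NE2/3/4.  ABSOLUTE RULE kept: no cite tag created, no printed statement used; [folklore] bookkeeping.
-/

noncomputable section

open MeasureTheory Finset Filter Topology
open scoped NNReal ENNReal symmDiff

namespace Summit.QuantumFields.BalabanUV.T4Continuum.NE7cSmoothing

open Literature.MathematicalPhysics.QuantumFieldTheory.Balaban1983to89
open T4Continuum T4LevelShift T4AveragingDisintegration T4WindowLevelShift T4LipschitzLedger T4FiniteEpsInhabited
  BlockAveraging ExpMeanLog T4FinestToWindow T4AgeZeroLayer T4PatternLayer T4SupCloseLiaison T4EtaRateMin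
open T4IndicatorShell T4LipschitzCutoff T4WeightBudget T4HybridMatching T4CauchySum T4ShellCount

/-! ## §1 The width dictum: smoothing at the discrepancy scale gains nothing; at a fixed width it gains `ρ/κ` with no law -/

/-- **NO GAIN AT THE DISCREPANCY SCALE.**  A Lipschitz cut-off profile of relative transition width `κ` has Lipschitz constant
`L ≥ κ⁻¹` (`LipProfile.one_le_L_mul_kappa`); so if the width is taken EQUAL to the two-run relative discrepancy `ρ` (the brief's
literal «smooth partition at width ρ_jθ_i»), the per-slot transfer factor `L·ρ` of `profile_sub_min_le_rel` is `≥ 1`: the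
profiled mismatch is no smaller than a sharp shell indicator, and the shell MASS must again be estimated (road P1). [folklore] -/
theorem no_transfer_gain_at_width_eq {χ : ℝ → ℝ} {ρ L : ℝ} (h : LipProfile χ ρ L) : 1 ≤ L * ρ :=
  h.one_le_L_mul_kappa

/-- **THE GAIN AT A FIXED WIDTH, NO LAW OF THE TESTED VARIABLE.**  With the piecewise-linear profile of fixed width `κ ∈ (0,1)`
(`linProfile κ`, Lipschitz constant `κ⁻¹`), threshold `θ > 0` and two tested values `Δ`-close with `Δ = ρθ`, run A's profile
factor exceeds the common min-core by at most `(ρ/κ) ×` the indicator of run A's OWN lowered layer `{u_A ≥ (1 − κ − ρ)θ}` —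
deterministic, pointwise, for every pair of values (`T4LipschitzCutoff.profile_sub_min_le_rel` at `L = κ⁻¹`). [folklore] -/
theorem transfer_factor_linProfile {κ θ uA uB ρ : ℝ} (h0 : 0 < κ) (h1 : κ < 1) (hθ : 0 < θ)
    (hΔ : |uA - uB| ≤ ρ * θ) :
    linProfile κ (uA / θ) - min (linProfile κ (uA / θ)) (linProfile κ (uB / θ)) ≤
      ρ / κ * largeInd uA ((1 - κ - ρ) * θ) := by
  have h := (linProfile_lipProfile h0 h1).profile_sub_min_le_rel hθ hΔ
  have e : κ⁻¹ * ρ = ρ / κ := by rw [div_eq_mul_inv, mul_comm]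
  rwa [e] at h

/-! ## §2 END-W: `ShellWeightBound` for the all-patterned (η)-layer from the two-run closeness of the window functionals -/

section EndW

variable {ι₀ : Type*} {N : ℕ} [NeZero N] (F : T4Family)

/-- **END-W — NE7c FOR THE ALL-PATTERNED LIPSCHITZ-PROFILED LAYER, FROM THE TWO-RUN CLOSENESS ALONE.**  Data: profiles
`χ_a` with `LipProfile (χ a) (κ a) (Lχ a)`; older histories `T₀ K` with `K`-free window depth `NW₀ τ' ≤ K`; `m₀ K τ'` declared
profile factors, factor `i` in slot `slot₀ K τ' i` of age `≤ min(N₀, K)` with `< n a` copies per age, ONE factor per slot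
(`hinj`), threshold `θ₀ K τ' i > 0`, MEASURABLE window functionals `vA K τ' i`, `vB K τ' i` of the window field; older weights
`RA K t τ'` / `RB K t τ'` a.e. nonnegative and integrable on run A's / run B's finest level.  Hypothesis with content: the
two-run closeness `hvc` (`|vA − vB| ≤ ρ(K − a_i)·θ_i` a.e.) with `0 ≤ ρ` SUMMABLE.  Conclusion: the literal
`T4IndicatorShell.ShellWeightBound` for the layered families `layerT₂ T₀ m₀` (terms = older history × polarity pattern), their
DEFINED weights `layerX₂` in the two runs, their realized shell parts on the window, and the band weight
`K ↦ Σ_{a ≤ N₀} n a · lipWeight Lχ 2 ρ a K` — sibling suppression `2` by the flip involution, empty fixed block. [folklore] -/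
theorem shellWeightBound_patterned {l₀ : ℝ} {T₀ : ℕ → Finset ι₀} {ρ : ℕ → ℝ}
    {χ : ℕ → ℝ → ℝ} {κ Lχ : ℕ → ℝ} (hχ : ∀ a, LipProfile (χ a) (κ a) (Lχ a)) {N₀ : ℕ} {n : ℕ → ℕ}
    {NW₀ : ι₀ → ℕ} (hNW : ∀ K, ∀ τ' ∈ T₀ K, NW₀ τ' ≤ K) {m₀ : ℕ → ι₀ → ℕ} {slot₀ : ℕ → ι₀ → ℕ → Σ _ : ℕ, ℕ}
    (hwin : ∀ K, ∀ τ' ∈ T₀ K, ∀ i < m₀ K τ', slot₀ K τ' i ∈ (range (N₀ + 1)).sigma fun a => range (n a))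
    (hband : ∀ K, ∀ τ' ∈ T₀ K, ∀ i < m₀ K τ', (slot₀ K τ' i).1 ≤ K)
    (hinj : ∀ K, ∀ τ' ∈ T₀ K, ∀ j < m₀ K τ', ∀ j' < m₀ K τ', slot₀ K τ' j = slot₀ K τ' j' → j = j')
    {fpol : ℕ → ι₀ → ℕ → Pol} {θ₀ : ℕ → ι₀ → ℕ → ℝ} (hθ : ∀ K, ∀ τ' ∈ T₀ K, ∀ i < m₀ K τ', 0 < θ₀ K τ' i)
    {vA vB : (K : ℕ) → (τ' : ι₀) → ℕ → GaugeField (F.P (NW₀ τ')) 0 (SU N) → ℝ}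
    (hvm : ∀ K, ∀ τ' ∈ T₀ K, ∀ i < m₀ K τ', Measurable (vA K τ' i) ∧ Measurable (vB K τ' i))
    (hvc : ∀ K, ∀ τ' ∈ T₀ K, ∀ i < m₀ K τ', ∀ᵐ V ∂fieldMeasure (F.P (NW₀ τ')) 0 (SU N),
      |vA K τ' i V - vB K τ' i V| ≤ ρ (K - (slot₀ K τ' i).1) * θ₀ K τ' i)
    {RA : (K : ℕ) → ℝ → ι₀ → GaugeField (F.P K) 0 (SU N) → ℝ}
    {RB : (K : ℕ) → ℝ → ι₀ → GaugeField (F.P (K + 1)) 0 (SU N) → ℝ}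
    (hRA0 : ∀ K t, |t| ≤ l₀ → ∀ τ' ∈ T₀ K, 0 ≤ᵐ[fieldMeasure (F.P K) 0 (SU N)] RA K t τ')
    (hRAi : ∀ K t, |t| ≤ l₀ → ∀ τ' ∈ T₀ K, Integrable (RA K t τ') (fieldMeasure (F.P K) 0 (SU N)))
    (hRB0 : ∀ K t, |t| ≤ l₀ → ∀ τ' ∈ T₀ K, 0 ≤ᵐ[fieldMeasure (F.P (K + 1)) 0 (SU N)] RB K t τ')
    (hRBi : ∀ K t, |t| ≤ l₀ → ∀ τ' ∈ T₀ K, Integrable (RB K t τ') (fieldMeasure (F.P (K + 1)) 0 (SU N)))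
    (hρ0 : ∀ j, 0 ≤ ρ j) (hρ : Summable ρ) :
    ShellWeightBound l₀ (layerT₂ T₀ m₀)
      (layerX₂ F χ NW₀ m₀ m₀ slot₀ fpol θ₀ vA (fun K => K) RA)
      (layerX₂ F χ NW₀ m₀ m₀ slot₀ fpol θ₀ vB (fun K => K + 1) RB)
      (shellW χ (fun _ τ => fieldMeasure (F.P (NW₀ τ.1)) 0 (SU N)) (layerM₂ m₀) (layerSlot₂ slot₀) (layerPol₂ m₀ fpol)
        (layerThr θ₀) (layerVar₂ vA) (layerVar₂ vB)
        (fun K t τ V => (oldDensity F (expMeanLogSU : LoopAverage (SU N)) K (NW₀ τ.1) (layerRem RA K t τ) V : ℝ)))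
      (shellW χ (fun _ τ => fieldMeasure (F.P (NW₀ τ.1)) 0 (SU N)) (layerM₂ m₀) (layerSlot₂ slot₀) (layerPol₂ m₀ fpol)
        (layerThr θ₀) (layerVar₂ vB) (layerVar₂ vA)
        (fun K t τ V => (oldDensity F (expMeanLogSU : LoopAverage (SU N)) (K + 1) (NW₀ τ.1) (layerRem RB K t τ) V : ℝ)))
      (fun K => ∑ a ∈ range (N₀ + 1), (n a : ℝ) * lipWeight Lχ (fun _ => 2) ρ a K) := by
  -- both runs' finest-level representations of the layer (the layer weights are DEFINED as the representing integrals)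
  have hA := termRepr_layer₂_A F (md := m₀) (fpol := fpol) hχ hθ hwin hband hvm hRA0 hRAi
  have hB := termRepr_layer₂_B F (md := m₀) (fpol := fpol) hχ hθ hwin hband
    (fun K τ hτ i hi => (hvm K τ hτ i hi).symm) hRB0 hRBi
  -- transport to the common K-free window of depth `NW₀ τ.1`
  have hT : ∀ K, ∀ τ ∈ layerT₂ T₀ m₀ K, (fun τ : ι₀ × Finset ℕ => NW₀ τ.1) τ ≤ K := fun K τ hτ =>
    hNW K τ.1 (mem_layerT₂.1 hτ).1
  have hmeas : ∀ K, ∀ τ ∈ layerT₂ T₀ m₀ K, ∀ i < layerM₂ m₀ K τ,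
      Measurable (layerVar₂ vA K τ i) ∧ Measurable (layerVar₂ vB K τ i) := fun K τ hτ i hi =>
    hvm K τ.1 (mem_layerT₂.1 hτ).1 i hi
  have hwA : TermRepr l₀ (layerT₂ T₀ m₀) (layerX₂ F χ NW₀ m₀ m₀ slot₀ fpol θ₀ vA (fun K => K) RA) χ κ Lχ N₀ n
      (fun _ τ => fieldMeasure (F.P (NW₀ τ.1)) 0 (SU N)) (layerM₂ m₀) (layerSlot₂ slot₀) (layerPol₂ m₀ fpol) (layerThr θ₀)
      (layerVar₂ vA) (layerVar₂ vB)
      (fun K t τ V => (oldDensity F (expMeanLogSU : LoopAverage (SU N)) ((fun K => K) K) (NW₀ τ.1) (layerRem RA K t τ) V : ℝ)) :=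
    termRepr_window_of_finest_A F (fun τ : ι₀ × Finset ℕ => NW₀ τ.1) hT hmeas hA
  have hwB : TermRepr l₀ (layerT₂ T₀ m₀) (layerX₂ F χ NW₀ m₀ m₀ slot₀ fpol θ₀ vB (fun K => K + 1) RB) χ κ Lχ N₀ n
      (fun _ τ => fieldMeasure (F.P (NW₀ τ.1)) 0 (SU N)) (layerM₂ m₀) (layerSlot₂ slot₀) (layerPol₂ m₀ fpol) (layerThr θ₀)
      (layerVar₂ vB) (layerVar₂ vA)
      (fun K t τ V => (oldDensity F (expMeanLogSU : LoopAverage (SU N)) ((fun K => K + 1) K) (NW₀ τ.1) (layerRem RB K t τ) V : ℝ)) :=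
    termRepr_window_of_finest_B F (fun τ : ι₀ × Finset ℕ => NW₀ τ.1) (fun K τ hτ => Nat.le_succ_of_le (hT K τ hτ))
      (fun K τ hτ i hi => (hmeas K τ hτ i hi).symm) hB
  -- the fixed block is EMPTY: its sibling suppression is `0`, structurally
  have h0 : ∀ K, ∀ τ' ∈ T₀ K, fixM m₀ m₀ K τ' = 0 := fun K τ' _ => Nat.sub_self _
  have hfixA : SiblingSuppression l₀ T₀ (fixW F χ NW₀ m₀ m₀ slot₀ fpol θ₀ vA (fun K => K) RA) N₀ n
      (fixSibW F χ κ NW₀ m₀ m₀ slot₀ fpol θ₀ vA (fun K => K) RA ρ) (fun _ => 0) :=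
    siblingSuppression_sibW_of_eq_zero h0
  have hfixB : SiblingSuppression l₀ T₀ (fixW F χ NW₀ m₀ m₀ slot₀ fpol θ₀ vB (fun K => K + 1) RB) N₀ n
      (fixSibW F χ κ NW₀ m₀ m₀ slot₀ fpol θ₀ vB (fun K => K + 1) RB ρ) (fun _ => 0) :=
    siblingSuppression_sibW_of_eq_zero h0
  -- sibling suppression `2 + 0` in both runs by the polarity-flip involution of the patterned block
  have hSA := siblingSuppression_layer₂ F (fun K => K) (ρ := ρ) (fun _ _ _ => le_rfl) hinj hwA
    (siblingSuppression_layerSibWf_of_fixed F (fun K => K) hχ (fun _ _ _ => le_rfl) hvm hRAi hwA hfixA)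
  have hSB := siblingSuppression_layer₂ F (fun K => K + 1) (ρ := ρ) (fun _ _ _ => le_rfl) hinj hwB
    (siblingSuppression_layerSibWf_of_fixed F (fun K => K + 1) hχ (fun _ _ _ => le_rfl)
      (fun K τ hτ i hi => (hvm K τ hτ i hi).symm) hRBi hwB hfixB)
  -- the two-run closeness of the window functionals, lifted to the layer (it reads the older history only)
  have hF : SupClose (layerT₂ T₀ m₀) (fun _ τ => fieldMeasure (F.P (NW₀ τ.1)) 0 (SU N)) (layerM₂ m₀) (layerSlot₂ slot₀)
      (layerThr θ₀) (layerVar₂ vA) (layerVar₂ vB) ρ := fun K τ hτ i hi => hvc K τ.1 (mem_layerT₂.1 hτ).1 i hi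
  have hS : ∀ a ≤ N₀, 0 ≤ (fun a => 2 + (fun _ : ℕ => (0 : ℝ)) a) a := fun a _ => by
    show (0 : ℝ) ≤ 2 + 0
    norm_num
  have main := shellWeightBound_of_repr hwA hwB hF hSA hSB hS hρ0 hρ
  have e : (fun a : ℕ => (2 : ℝ) + (fun _ : ℕ => (0 : ℝ)) a) = fun _ => 2 := by
    funext a
    simp
  rw [e] at main
  exact main

end EndW

/-! ## §3 END-R: the two-run closeness DISCHARGED from node U1b's `LocalRate` (spine estimate NE3, a binder) -/

section EndR

variable {ι₀ Dat Sit : Type*} {N : ℕ} [NeZero N] (F : T4Family)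

/-- lift of the realisation convention from the older histories to the layer (the layer reads `τ.1` only). [folklore] -/
theorem readsLevels_layer {T₀ : ℕ → Finset ι₀} {NW₀ : ι₀ → ℕ} {m₀ : ℕ → ι₀ → ℕ} {slot₀ : ℕ → ι₀ → ℕ → Σ _ : ℕ, ℕ}
    {vA vB : (K : ℕ) → (τ' : ι₀) → ℕ → GaugeField (F.P (NW₀ τ')) 0 (SU N) → ℝ} {R : Readings Dat Sit}
    (hR : ReadsLevels R T₀ (fun _ τ' => fieldMeasure (F.P (NW₀ τ')) 0 (SU N)) m₀ slot₀ vA vB) :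
    ReadsLevels R (layerT₂ T₀ m₀) (fun _ τ => fieldMeasure (F.P (NW₀ τ.1)) 0 (SU N)) (layerM₂ m₀) (layerSlot₂ slot₀)
      (layerVar₂ vA) (layerVar₂ vB) := fun K τ hτ i hi =>
  hR K τ.1 (mem_layerT₂.1 hτ).1 i hi

/-- lift of the threshold floor from the older histories to the layer. [folklore] -/
theorem thresholdFloor_layer {T₀ : ℕ → Finset ι₀} {m₀ : ℕ → ι₀ → ℕ} {θ₀ : ℕ → ι₀ → ℕ → ℝ} {θmin : ℝ}
    (hθf : ThresholdFloor T₀ m₀ θ₀ θmin) :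
    ThresholdFloor (layerT₂ T₀ m₀) (layerM₂ m₀) (layerThr θ₀) θmin := fun K τ hτ i hi =>
  hθf K τ.1 (mem_layerT₂.1 hτ).1 i hi

/-- **END-R — NE7c FOR THE ALL-PATTERNED LIPSCHITZ-PROFILED LAYER FROM NODE U1b's `LocalRate`.**  END-W with its only contentful
hypothesis, the two-run closeness `hvc`, DISCHARGED: node U1b's `T4EtaRateMin.LocalRate R C ϑ` (`0 ≤ C`, `0 ≤ ϑ < 1` — spine estimate
NE3's output shape, a BINDER, NOT PRINTED), the realisation convention `ReadsLevels` (the declared window functionals of both runs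
ARE the readings of the `j`-step / `(j+1)`-step local minimisers at a common datum, `j` = the slot's level — node U5a's coupling)
and a `K`-uniform positive threshold floor `θmin` over the window (node U2 / window arithmetic, `T4SupCloseLiaison` HONEST LIMITS
(b) and §5d–§5e).  Width `ρ_j = (C/θmin)ϑ^j`; band weight `K ↦ Σ_{a≤N₀} n a · lipWeight Lχ 2 (geomWidth C θmin ϑ) a K`. [folklore] -/
theorem shellWeightBound_patterned_of_localRate {l₀ : ℝ} {T₀ : ℕ → Finset ι₀} {R : Readings Dat Sit} {C ϑ θmin : ℝ}
    {χ : ℕ → ℝ → ℝ} {κ Lχ : ℕ → ℝ} (hχ : ∀ a, LipProfile (χ a) (κ a) (Lχ a)) {N₀ : ℕ} {n : ℕ → ℕ}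
    {NW₀ : ι₀ → ℕ} (hNW : ∀ K, ∀ τ' ∈ T₀ K, NW₀ τ' ≤ K) {m₀ : ℕ → ι₀ → ℕ} {slot₀ : ℕ → ι₀ → ℕ → Σ _ : ℕ, ℕ}
    (hwin : ∀ K, ∀ τ' ∈ T₀ K, ∀ i < m₀ K τ', slot₀ K τ' i ∈ (range (N₀ + 1)).sigma fun a => range (n a))
    (hband : ∀ K, ∀ τ' ∈ T₀ K, ∀ i < m₀ K τ', (slot₀ K τ' i).1 ≤ K)
    (hinj : ∀ K, ∀ τ' ∈ T₀ K, ∀ j < m₀ K τ', ∀ j' < m₀ K τ', slot₀ K τ' j = slot₀ K τ' j' → j = j')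
    {fpol : ℕ → ι₀ → ℕ → Pol} {θ₀ : ℕ → ι₀ → ℕ → ℝ} (hmin : 0 < θmin) (hθf : ThresholdFloor T₀ m₀ θ₀ θmin)
    {vA vB : (K : ℕ) → (τ' : ι₀) → ℕ → GaugeField (F.P (NW₀ τ')) 0 (SU N) → ℝ}
    (hvm : ∀ K, ∀ τ' ∈ T₀ K, ∀ i < m₀ K τ', Measurable (vA K τ' i) ∧ Measurable (vB K τ' i))
    (hloc : LocalRate R C ϑ) (hC : 0 ≤ C) (hϑ0 : 0 ≤ ϑ) (hϑ1 : ϑ < 1)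
    (hR : ReadsLevels R T₀ (fun _ τ' => fieldMeasure (F.P (NW₀ τ')) 0 (SU N)) m₀ slot₀ vA vB)
    {RA : (K : ℕ) → ℝ → ι₀ → GaugeField (F.P K) 0 (SU N) → ℝ}
    {RB : (K : ℕ) → ℝ → ι₀ → GaugeField (F.P (K + 1)) 0 (SU N) → ℝ}
    (hRA0 : ∀ K t, |t| ≤ l₀ → ∀ τ' ∈ T₀ K, 0 ≤ᵐ[fieldMeasure (F.P K) 0 (SU N)] RA K t τ')
    (hRAi : ∀ K t, |t| ≤ l₀ → ∀ τ' ∈ T₀ K, Integrable (RA K t τ') (fieldMeasure (F.P K) 0 (SU N)))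
    (hRB0 : ∀ K t, |t| ≤ l₀ → ∀ τ' ∈ T₀ K, 0 ≤ᵐ[fieldMeasure (F.P (K + 1)) 0 (SU N)] RB K t τ')
    (hRBi : ∀ K t, |t| ≤ l₀ → ∀ τ' ∈ T₀ K, Integrable (RB K t τ') (fieldMeasure (F.P (K + 1)) 0 (SU N))) :
    ShellWeightBound l₀ (layerT₂ T₀ m₀)
      (layerX₂ F χ NW₀ m₀ m₀ slot₀ fpol θ₀ vA (fun K => K) RA)
      (layerX₂ F χ NW₀ m₀ m₀ slot₀ fpol θ₀ vB (fun K => K + 1) RB)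
      (shellW χ (fun _ τ => fieldMeasure (F.P (NW₀ τ.1)) 0 (SU N)) (layerM₂ m₀) (layerSlot₂ slot₀) (layerPol₂ m₀ fpol)
        (layerThr θ₀) (layerVar₂ vA) (layerVar₂ vB)
        (fun K t τ V => (oldDensity F (expMeanLogSU : LoopAverage (SU N)) K (NW₀ τ.1) (layerRem RA K t τ) V : ℝ)))
      (shellW χ (fun _ τ => fieldMeasure (F.P (NW₀ τ.1)) 0 (SU N)) (layerM₂ m₀) (layerSlot₂ slot₀) (layerPol₂ m₀ fpol)
        (layerThr θ₀) (layerVar₂ vB) (layerVar₂ vA)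
        (fun K t τ V => (oldDensity F (expMeanLogSU : LoopAverage (SU N)) (K + 1) (NW₀ τ.1) (layerRem RB K t τ) V : ℝ)))
      (fun K => ∑ a ∈ range (N₀ + 1), (n a : ℝ) * lipWeight Lχ (fun _ => 2) (geomWidth C θmin ϑ) a K) := by
  -- positive thresholds from the floor
  have hθ : ∀ K, ∀ τ' ∈ T₀ K, ∀ i < m₀ K τ', 0 < θ₀ K τ' i := hθf.thr_pos hmin
  -- the two-run closeness with the geometric width, from `LocalRate` through the liaison (at the layer, then read back)
  have hF : SupClose (layerT₂ T₀ m₀) (fun _ τ => fieldMeasure (F.P (NW₀ τ.1)) 0 (SU N)) (layerM₂ m₀) (layerSlot₂ slot₀)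
      (layerThr θ₀) (layerVar₂ vA) (layerVar₂ vB) (geomWidth C θmin ϑ) :=
    supClose_of_localRate hloc (readsLevels_layer F hR) hmin (thresholdFloor_layer hθf)
  have hF₀ : SupClose T₀ (fun _ τ' => fieldMeasure (F.P (NW₀ τ')) 0 (SU N)) m₀ slot₀ θ₀ vA vB (geomWidth C θmin ϑ) :=
    supClose_of_localRate hloc hR hmin hθf
  exact shellWeightBound_patterned F hχ hNW hwin hband hinj hθ hvm
    (fun K τ' hτ' i hi => hF₀ K τ' hτ' i hi) hRA0 hRAi hRB0 hRBi
    (geomWidth_nonneg hC hmin.le hϑ0) (summable_geomWidth hϑ0 hϑ1)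

end EndR

/-! ## §4 The price faces: the total in closed form, the geometric decay in `K`, and the budget on a tail -/

section Price

/-- **THE TOTAL TWO-RUN COST OF ROAD P3 IN CLOSED FORM:** `Σ_K Wsh_K = C₀(n, 2L) · (C/θmin)(1 − ϑ)⁻¹` — cube count × Lipschitz
constant × the structural sibling factor `2`, summed ONCE over the window of ages, times NE3's total width over levels
(`T4SupCloseLiaison.tsum_bandWeight_eq` at `S ≡ 2`). [folklore] -/
theorem tsum_bandWeight_patterned {N₀ : ℕ} (n : ℕ → ℕ) (Lχ : ℕ → ℝ) {C θmin ϑ : ℝ} (hϑ0 : 0 ≤ ϑ) (hϑ1 : ϑ < 1) :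
    ∑' K, (∑ a ∈ range (N₀ + 1), (n a : ℝ) * lipWeight Lχ (fun _ => 2) (geomWidth C θmin ϑ) a K)
      = C0 N₀ (fun a => (n a : ℝ)) (fun a => Lχ a * 2) * (C / θmin * (1 - ϑ)⁻¹) :=
  tsum_bandWeight_eq n Lχ (fun _ => 2) hϑ0 hϑ1

/-- **THE BAND WEIGHT IS GEOMETRIC IN `K`** (`ϑ > 0`): `Wsh_K ≤ [(C/θmin) Σ_{a≤N₀} n_a · 2L_a ϑ^{−a}] · ϑ^K` — the window of
ages costs `ϑ^{−N₀}` once, `K`-free. [folklore] -/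
theorem bandWeight_patterned_le_geometric {N₀ : ℕ} (n : ℕ → ℕ) {Lχ : ℕ → ℝ} {C θmin ϑ : ℝ} (hL : ∀ a ≤ N₀, 0 ≤ Lχ a)
    (hC : 0 ≤ C) (hmin : 0 < θmin) (hϑ0 : 0 < ϑ) (K : ℕ) :
    ∑ a ∈ range (N₀ + 1), (n a : ℝ) * lipWeight Lχ (fun _ => 2) (geomWidth C θmin ϑ) a K
      ≤ (C / θmin * ∑ a ∈ range (N₀ + 1), (n a : ℝ) * (Lχ a * 2 * ϑ⁻¹ ^ a)) * ϑ ^ K :=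
  bandWeight_le_geometric n hL (fun _ _ => by norm_num) hC hmin hϑ0 K

/-- **THE BUDGET HOLDS ON A TAIL.**  If the bad-class weights `W` of NE7b are eventually `≤ 1/2` and the shell weights `Wsh` are
summable (END-W / END-R), then `W K + Wsh K < 1` for all `K` from some `K₁` on — the only form of the weight condition the
seam-(ζ′) socket `T4MatchingClosureSocket.hybridNE7_closure'_tail` consumes (no `lt_one` at every `K` is claimed or needed).
[folklore] -/
theorem budget_tail {W Wsh : ℕ → ℝ} (hW : ∀ᶠ K in atTop, W K ≤ 1 / 2) (hsum : Summable Wsh) :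
    ∀ᶠ K in atTop, W K + Wsh K < 1 := by
  have h2 : ∀ᶠ K in atTop, Wsh K < 1 / 2 := by
    have ht := hsum.tendsto_atTop_zero
    exact (ht.eventually (gt_mem_nhds (by norm_num : (0 : ℝ) < 1 / 2)))
  filter_upwards [hW, h2] with K h1 h3
  linarith

end Price

end Summit.QuantumFields.BalabanUV.T4Continuum.NE7cSmoothing

end
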